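import Summits.CriticalPhenomena.PercolationContinuityZ3.Theorems.PercNearOneGluingNoHeavyLowerTailKnQuestion9TwoRelays
import Literature.Probability.Percolation.TwoSetConditionalAssociation
import Literature.Probability.Percolation.KozmaNitzanSeparatingTriple
import HarnessLib

/-!
# KN Question 8/9 at three relays — the attachment piece (BHK-D) of the pocket certificate for the Question-9 pocket `C_o = {o}`

Support file (`--supports stmt-CriticalPhenomena-4575`, closed), prover `prim-cplus-coupling` (gen 21).  No definitions, no named
facts, no sorries; standard axioms.  Companion of `…KnQuestion8PocketQ9Cov.lean` (`PocketCert.pcov_questionNine`, PCOV = (P1**-D) for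
the same pocket); memo `prim-cplus-coupling/A5-COUPLING-gen21.md` §0(8).

prim-lf-2's pocket-designated certificate (memo POCKET-CERT-gen16 §3, tree `PocketCert.p1star_pocket_of_pieces`) splits the owner's half
(P1*D) into (BHK-D) and (P1**-D).  For the Question-8 pocket (BHK-D) is `PocketCert.attach_of_setAvoid` (one application of vdBHK Thm 2.1);
for the QUESTION-9 pocket `{C_o = {o}}` ("proved on paper by the star decomposition", lf-2 gen 16) this file gives the Lean proof:
  **`μ({x↔o} ∩ E1) · μ(σ_∅ ∩ E1 ∩ {C_x ∈ 𝒰}) ≤ μ(σ_∅ ∩ E1) · μ({x↔o} ∩ E1 ∩ {C_x ∈ 𝒰})`**,  `E1 = {x↮y} ∩ {x↮z}`, `σ_∅ = starEvent o ∅`,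
i.e. `E[1_𝒰(C_x) | o ∈ C_x, x↮{y,z}] ≥ E[1_𝒰(C_x) | C_o = {o}, x↮{y,z}]` for every up-set `𝒰`.
PROOF: star decomposition at `o` (`KNPreFKG.real_eq_sum_inter_starEvent`, `walk_decomp`, `KNGoodAux.real_starEvent_inter_of_determinedBy`):
`μ({x↔o} ∩ E1) = Σ_B μ(σ_B)·μ_H(x↔B, y↮B, z↮B)`, `μ({x↔o} ∩ E1 ∩ U) ≥ Σ_B μ(σ_B)·μ_H({x↔B, y↮B, z↮B} ∩ U)`, `μ(σ_∅ ∩ E) = μ(σ_∅)·μ_H(E)`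
(`H = G ∖ o`); per star, in `H`: `E_H[1_𝒰 | x↔B, ({x}∪B)↮{y,z}] ≥ E_H[1_𝒰 | ({x}∪B)↮{y,z}]` (vdBHK Thm 2.1 for the set `S = {x}∪B`,
`BHK2006_setClusterConditionalPositiveAssociation`) and `E_H[1_𝒰 | ({x}∪B)↮{y,z}] ≥ E_H[1_𝒰 | x↮{y,z}]` (two-set form, `S = {x}`, `T = {y,z}`,
decreasing function `1{B↮T}` of `C_T`, `BHK2006_twoSetConditionalAssociation`).
[cite: KozmaNitzan2024, Questions 8–9 (§5.5 p. 36), Lemma 5 and proof of Thm. 4 (pp. 13–14)]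
[cite: VandenbergHaggstromKahn2005, Thm. 2.1 (p. 9), Thm. 1.5 (p. 7), Remark 1 (p. 5)]
-/

namespace Summit.CriticalPhenomena.PercolationContinuityZ3.Theorems

open MeasureTheory Set Literature.Probability.LatticeModels Literature.Probability.Percolation
open scoped Classical
open KNPreFKG

noncomputable section

namespace PocketCert

variable {V : Type*} [Fintype V]

/-- **(BHK-D) for the Question-9 pocket.**  Owner `x`, avoided relays `y, z`, observer `o` (`x, y, z ≠ o`), `𝒰` an up-set of vertex
sets, `E1 = {x↮y} ∩ {x↮z}`, `σ_∅ = {no open pair at o}`: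
`μ({x↔o} ∩ E1) · μ(σ_∅ ∩ E1 ∩ {C_x ∈ 𝒰}) ≤ μ(σ_∅ ∩ E1) · μ({x↔o} ∩ E1 ∩ {C_x ∈ 𝒰})`,
i.e. `E[1_𝒰(C_x) | o ∈ C_x, x↮{y,z}] ≥ E[1_𝒰(C_x) | C_o = {o}, x↮{y,z}]` — prim-lf-2's attachment piece (BHK-D) of the pocket certificate
(`PocketCert.p1star_pocket_of_pieces`) for the pocket `{C_o = {o}}` (memo POCKET-CERT-gen16 §3: "Q9: proved on paper by the star
decomposition"; here in Lean).  Proof: star decomposition at `o` as in `pcov_questionNine`; per star `B`, in `H = G ∖ o`: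
`E_H[1_𝒰 | x↔B, ({x}∪B)↮{y,z}] ≥ E_H[1_𝒰 | ({x}∪B)↮{y,z}] ≥ E_H[1_𝒰 | x↮{y,z}]` — vdBHK Thm 2.1 for the set `S = {x} ∪ B`
(`BHK2006_setClusterConditionalPositiveAssociation`), then vdBHK Thm 1.5/2.1 in two-set form for `S = {x}`, `T = {y,z}` with the
decreasing function `1{B ↮ T}` of `C_T` (`BHK2006_twoSetConditionalAssociation`).
[cite: KozmaNitzan2024, Questions 8–9 (§5.5 p. 36), Lemma 5 (p. 13)] [cite: VandenbergHaggstromKahn2005, Thm. 2.1 (p. 9), Thm. 1.5 (p. 7)] -/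
theorem attach_questionNine (w : Sym2 V → unitInterval) (o x y z : V) (hxo : x ≠ o) (hyo : y ≠ o) (hzo : z ≠ o)
    (𝒰 : Set (Set V)) (h𝒰 : IsUpperSet 𝒰) :
    (prodBernoulli w).real (openConn x o ∩ ({ω : BondConfig V | ¬ (openGraph ω).Reachable x y} ∩
          {ω | ¬ (openGraph ω).Reachable x z})) *
        (prodBernoulli w).real (starEvent o (∅ : Set V) ∩ ({ω : BondConfig V | ¬ (openGraph ω).Reachable x y} ∩
          {ω | ¬ (openGraph ω).Reachable x z}) ∩ {ω | openCluster ω x ∈ 𝒰}) ≤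
      (prodBernoulli w).real (starEvent o (∅ : Set V) ∩ ({ω : BondConfig V | ¬ (openGraph ω).Reachable x y} ∩
          {ω | ¬ (openGraph ω).Reachable x z})) *
        (prodBernoulli w).real (openConn x o ∩ ({ω : BondConfig V | ¬ (openGraph ω).Reachable x y} ∩
          {ω | ¬ (openGraph ω).Reachable x z}) ∩ {ω | openCluster ω x ∈ 𝒰}) := by
  classical
  set μ := prodBernoulli w with hμ
  have hn := fun (S' : Set (BondConfig V)) => (measureReal_nonneg : 0 ≤ μ.real S')
  set S : Set V := ({o}ᶜ : Set V) with hS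
  set μH := prodBernoulli (restrW S w) with hμH
  have hnH := fun (S' : Set (BondConfig V)) => (measureReal_nonneg : 0 ≤ μH.real S')
  set E1 : Set (BondConfig V) := {ω : BondConfig V | ¬ (openGraph ω).Reachable x y} ∩
      {ω | ¬ (openGraph ω).Reachable x z} with hE1
  set AU : Set (BondConfig V) := {ω : BondConfig V | openCluster ω x ∈ 𝒰} with hAU
  set σ0 : Set (BondConfig V) := starEvent o (∅ : Set V) with hσ0
  set XB : Finset V → Set (BondConfig V) := fun B =>
      {ω : BondConfig V | ∃ u ∈ B, (openGraph ω).Reachable x u} ∩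
        ({ω | ∀ u ∈ B, ¬ (openGraph ω).Reachable y u} ∩ {ω | ∀ u ∈ B, ¬ (openGraph ω).Reachable z u}) with hXB
  set cut : BondConfig V → BondConfig V := fun ω => ω ∩ wireSet S with hcutdef
  have hdet : ∀ E : Set (BondConfig V), DeterminedBy {ω : BondConfig V | cut ω ∈ E} (wireSet S) := by
    intro E
    rw [determinedBy_iff]
    intro ω ω' hωω'
    simp only [hcutdef, mem_setOf_eq]
    rw [hωω']
  have hbr : ∀ E : Set (BondConfig V), μH.real E = μ.real {ω | cut ω ∈ E} := fun E => KNGoodAux.restrW_real_eq w S E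
  have hprod : ∀ (B : Set V) (E : Set (BondConfig V)),
      μ.real (starEvent o B ∩ {ω | cut ω ∈ E}) = μ.real (starEvent o B) * μH.real E := by
    intro B E
    rw [hbr E]
    exact KNGoodAux.real_starEvent_inter_of_determinedBy w o B (hdet E)
  have hxS : x ∈ S := mem_compl_singleton_iff.2 hxo
  have hcut : ∀ (ω : BondConfig V) {p : V} (hp : p ∈ S) (q : V),
      (openGraph (cut ω)).Reachable p q ↔ ω ∈ openConnIn S p q := fun ω p hp q =>
    KNGoodAux.inter_wireSet_mem_openConn_iff hp q
  have hcut_le : ∀ (ω : BondConfig V) (p q : V), (openGraph (cut ω)).Reachable p q → (openGraph ω).Reachable p q :=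
    fun ω p q h => h.mono (SimpleGraph.fromEdgeSet_mono inter_subset_left)
  have hdec : ∀ (B : Set V) (ω : BondConfig V), ω ∈ starEvent o B → ∀ {p q : V}, p ∈ S → q ≠ o →
      (openGraph ω).Reachable p q →
        (openGraph (cut ω)).Reachable p q ∨
          ((∃ u ∈ B, (openGraph (cut ω)).Reachable p u) ∧ ∃ u' ∈ B, (openGraph (cut ω)).Reachable u' q) := by
    intro B ω hσ p q hp hq hpq
    obtain ⟨pth⟩ := hpq
    rcases (KNPreFKG.walk_decomp hσ pth hq).1 (mem_compl_singleton_iff.1 hp) with h | ⟨⟨u, huB, huo, hpu⟩, ⟨u', hu'B, hu'o, hu'q⟩⟩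
    · exact Or.inl ((hcut ω hp q).2 h)
    · exact Or.inr ⟨⟨u, huB, (hcut ω hp u).2 hpu⟩, ⟨u', hu'B, (hcut ω (mem_compl_singleton_iff.2 hu'o) q).2 hu'q⟩⟩
  have hreach : ∀ (B : Set V) (ω : BondConfig V), ω ∈ starEvent o B → o ∉ B → ∀ u ∈ B, ∀ q : V,
      (openGraph (cut ω)).Reachable u q → (openGraph ω).Reachable o q := by
    intro B ω hσ hoB u huB q huq
    have huo : u ≠ o := fun h => hoB (h ▸ huB)
    have hou : s(o, u) ∈ ω := ((mem_starEvent_iff o B ω).1 hσ u huo).2 huB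
    have hadj : (openGraph ω).Adj o u := (openGraph_adj ω o u).2 ⟨hou, huo.symm⟩
    exact hadj.reachable.trans (hcut_le ω u q huq)
  have hA : ∀ (ω : BondConfig V), ω ∈ σ0 → ∀ {p : V}, p ∈ S → ∀ q : V,
      ((openGraph ω).Reachable p q ↔ (openGraph (cut ω)).Reachable p q) := by
    intro ω hσ p hp q
    constructor
    · intro hpq
      by_cases hq : q = o
      · exfalso
        subst hq
        obtain ⟨pth⟩ := hpq
        have key := (KNPreFKG.walk_decomp hσ pth.reverse (mem_compl_singleton_iff.1 hp)).2 rfl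
        obtain ⟨u', hu', -, -⟩ := key
        exact hu'
      · rcases hdec ∅ ω hσ hp hq hpq with h | ⟨⟨u, hu, -⟩, -⟩
        · exact h
        · exact absurd hu (Set.notMem_empty u)
    · exact hcut_le ω p q
  have hAcl : ∀ (ω : BondConfig V), ω ∈ σ0 → openCluster ω x = openCluster (cut ω) x := by
    intro ω hσ
    ext q
    exact hA ω hσ hxS q
  -- the reference masses factor
  have fE1 : σ0 ∩ E1 = σ0 ∩ {ω | cut ω ∈ E1} := by
    ext ω
    simp only [hE1, mem_inter_iff, mem_setOf_eq]
    constructor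
    · rintro ⟨hσ, h1, h2⟩; exact ⟨hσ, fun h' => h1 ((hA ω hσ hxS y).2 h'), fun h' => h2 ((hA ω hσ hxS z).2 h')⟩
    · rintro ⟨hσ, h1, h2⟩; exact ⟨hσ, fun h' => h1 ((hA ω hσ hxS y).1 h'), fun h' => h2 ((hA ω hσ hxS z).1 h')⟩
  have fE1U : σ0 ∩ E1 ∩ AU = σ0 ∩ {ω | cut ω ∈ E1 ∩ AU} := by
    ext ω
    simp only [hE1, hAU, mem_inter_iff, mem_setOf_eq]
    constructor
    · rintro ⟨⟨hσ, h1, h2⟩, hu⟩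
      exact ⟨hσ, ⟨fun h' => h1 ((hA ω hσ hxS y).2 h'), fun h' => h2 ((hA ω hσ hxS z).2 h')⟩, by rwa [← hAcl ω hσ]⟩
    · rintro ⟨hσ, ⟨h1, h2⟩, hu⟩
      exact ⟨⟨hσ, fun h' => h1 ((hA ω hσ hxS y).1 h'), fun h' => h2 ((hA ω hσ hxS z).1 h')⟩, by rwa [hAcl ω hσ]⟩
  set s0 : ℝ := μ.real σ0 with hs0
  have eE1 : μ.real (σ0 ∩ E1) = s0 * μH.real E1 := by rw [fE1]; exact hprod ∅ E1
  have eE1U : μ.real (σ0 ∩ E1 ∩ AU) = s0 * μH.real (E1 ∩ AU) := by rw [fE1U]; exact hprod ∅ (E1 ∩ AU)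
  -- star identities
  set A : Finset V := Finset.univ.erase o with hA'
  have hoA : o ∉ A := fun h => (Finset.mem_erase.1 h).1 rfl
  have hiso : ∀ u, u ≠ o → u ∉ A → w s(o, u) = 0 :=
    fun u huo hu => absurd (Finset.mem_erase.2 ⟨huo, Finset.mem_univ u⟩) hu
  have hoB : ∀ B ∈ A.powerset, o ∉ (B : Finset V) := fun B hB h => hoA (Finset.mem_powerset.1 hB h)
  have iX : ∀ B : Finset V, o ∉ B → openConn x o ∩ E1 ∩ starEvent o ↑B = starEvent o ↑B ∩ {ω | cut ω ∈ XB B} := by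
    intro B hoB'
    ext ω
    simp only [hE1, hXB, openConn, mem_inter_iff, mem_setOf_eq]
    constructor
    · rintro ⟨⟨hxo', hxy, hxz⟩, hσ⟩
      refine ⟨hσ, ?_, ?_, ?_⟩
      · obtain ⟨pth⟩ := (hxo'.symm : (openGraph ω).Reachable o x)
        obtain ⟨u', hu'B, hu'o, hu'x⟩ := (KNPreFKG.walk_decomp hσ pth hxo).2 rfl
        have h1 : (openGraph (cut ω)).Reachable u' x := (hcut ω (mem_compl_singleton_iff.2 hu'o) x).2 hu'x
        exact ⟨u', hu'B, h1.symm⟩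
      · intro u huB hyu
        exact hxy (hxo'.trans (hreach (↑B) ω hσ hoB' u huB y hyu.symm))
      · intro u huB hzu
        exact hxz (hxo'.trans (hreach (↑B) ω hσ hoB' u huB z hzu.symm))
    · rintro ⟨hσ, ⟨u, huB, hxu⟩, hyB, hzB⟩
      refine ⟨⟨(hreach (↑B) ω hσ hoB' u huB x hxu.symm).symm, ?_, ?_⟩, hσ⟩
      · intro hxy
        rcases hdec (↑B) ω hσ hxS hyo hxy with h | ⟨-, ⟨u', hu'B, hu'y⟩⟩
        · exact hyB u huB (h.symm.trans hxu)
        · exact hyB u' hu'B hu'y.symm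
      · intro hxz
        rcases hdec (↑B) ω hσ hxS hzo hxz with h | ⟨-, ⟨u', hu'B, hu'z⟩⟩
        · exact hzB u huB (h.symm.trans hxu)
        · exact hzB u' hu'B hu'z.symm
  have iXU : ∀ B : Finset V, o ∉ B → starEvent o ↑B ∩ {ω | cut ω ∈ XB B ∩ AU} ⊆ openConn x o ∩ E1 ∩ AU ∩ starEvent o ↑B := by
    intro B hoB' ω hω
    obtain ⟨hσ, hXBω, hUω⟩ := hω
    have h1 : ω ∈ openConn x o ∩ E1 ∩ starEvent o ↑B := by rw [iX B hoB']; exact ⟨hσ, hXBω⟩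
    refine ⟨⟨h1.1, ?_⟩, hσ⟩
    simp only [hAU, mem_setOf_eq] at hUω ⊢
    exact h𝒰 (openCluster_mono inter_subset_left x) hUω
  have sa : μ.real (openConn x o ∩ E1) = ∑ B ∈ A.powerset, μ.real (starEvent o ↑B) * μH.real (XB B) := by
    rw [KNPreFKG.real_eq_sum_inter_starEvent w A o hoA hiso (openConn x o ∩ E1)]
    refine Finset.sum_congr rfl fun B hB => ?_
    rw [iX B (hoB B hB)]
    exact hprod (↑B) (XB B)
  have sU : ∑ B ∈ A.powerset, μ.real (starEvent o ↑B) * μH.real (XB B ∩ AU) ≤ μ.real (openConn x o ∩ E1 ∩ AU) := by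
    rw [KNPreFKG.real_eq_sum_inter_starEvent w A o hoA hiso (openConn x o ∩ E1 ∩ AU)]
    refine Finset.sum_le_sum fun B hB => ?_
    rw [← hprod (↑B) (XB B ∩ AU)]
    exact measureReal_mono (iXU B (hoB B hB))
  -- the `H`-inequality for every star: `μ_H(XB) · μ_H(E1 ∩ U) ≤ μ_H(E1) · μ_H(XB ∩ U)`
  have hstar : ∀ B : Finset V, μH.real (XB B) * μH.real (E1 ∩ AU) ≤ μH.real E1 * μH.real (XB B ∩ AU) := by
    intro B
    set S' : Set V := insert x (↑B : Set V) with hS'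
    set T : Set V := ({y, z} : Set V) with hT
    set Δ : Set (BondConfig V) := {ω : BondConfig V | ∀ s ∈ S', ∀ t ∈ T, ¬ (openGraph ω).Reachable s t} with hΔ
    set Δx : Set (BondConfig V) := {ω : BondConfig V | ∀ s ∈ ({x} : Set V), ∀ t ∈ T, ¬ (openGraph ω).Reachable s t} with hΔx
    have hxS' : x ∈ S' := mem_insert x _
    -- monotone readings on the edge clusters
    set FU : Set (Sym2 V) → ℝ := fun C => if openCluster C x ∈ 𝒰 then 1 else 0 with hFU
    set GB : Set (Sym2 V) → ℝ := fun C => if ∃ u ∈ B, (openGraph C).Reachable x u then 1 else 0 with hGB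
    set HB : Set (Sym2 V) → ℝ := fun C => if ∀ t ∈ T, ∀ u ∈ B, ¬ (openGraph C).Reachable t u then 1 else 0 with hHB
    have hFU_mono : Monotone FU := by
      intro C C' hCC'
      simp only [hFU]
      by_cases h : openCluster C x ∈ 𝒰
      · rw [if_pos h, if_pos (h𝒰 (openCluster_mono hCC' x) h)]
      · rw [if_neg h]; split_ifs <;> norm_num
    have hGB_mono : Monotone GB := by
      intro C C' hCC'
      simp only [hGB]
      by_cases h : ∃ u ∈ B, (openGraph C).Reachable x u
      · obtain ⟨u, huB, hxu⟩ := h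
        rw [if_pos ⟨u, huB, hxu⟩, if_pos ⟨u, huB, hxu.mono (SimpleGraph.fromEdgeSet_mono hCC')⟩]
      · rw [if_neg h]; split_ifs <;> norm_num
    have hHB_anti : Antitone HB := by
      intro C C' hCC'
      simp only [hHB]
      by_cases h : ∀ t ∈ T, ∀ u ∈ B, ¬ (openGraph C').Reachable t u
      · rw [if_pos h, if_pos (fun t ht u hu h' => h t ht u hu (h'.mono (SimpleGraph.fromEdgeSet_mono hCC')))]
      · rw [if_neg h]; split_ifs <;> norm_num
    -- readings on `ω`
    have rFU : ∀ ω : BondConfig V, FU (⋃ s ∈ S', openEdgeCluster ω s) = AU.indicator 1 ω := by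
      intro ω
      have hcl : openCluster (⋃ s ∈ S', openEdgeCluster ω s) x = openCluster ω x := by
        ext a; exact (KNSep.reachable_iff_cluster ω S' hxS' a).symm
      simp only [hFU, hcl]
      by_cases h : openCluster ω x ∈ 𝒰
      · rw [if_pos h, indicator_of_mem (show ω ∈ AU from h)]; simp
      · rw [if_neg h, indicator_of_notMem (show ω ∉ AU from h)]
    have rFUx : ∀ ω : BondConfig V, FU (⋃ s ∈ ({x} : Set V), openEdgeCluster ω s) = AU.indicator 1 ω := by
      intro ω
      have hcl : openCluster (⋃ s ∈ ({x} : Set V), openEdgeCluster ω s) x = openCluster ω x := by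
        ext a; exact (KNSep.reachable_iff_cluster ω ({x} : Set V) (mem_singleton x) a).symm
      simp only [hFU, hcl]
      by_cases h : openCluster ω x ∈ 𝒰
      · rw [if_pos h, indicator_of_mem (show ω ∈ AU from h)]; simp
      · rw [if_neg h, indicator_of_notMem (show ω ∉ AU from h)]
    set XBev : Set (BondConfig V) := {ω : BondConfig V | ∃ u ∈ B, (openGraph ω).Reachable x u} with hXBev
    have rGB : ∀ ω : BondConfig V, GB (⋃ s ∈ S', openEdgeCluster ω s) = XBev.indicator 1 ω := by
      intro ω
      have hr : ∀ u, (openGraph (⋃ s ∈ S', openEdgeCluster ω s)).Reachable x u ↔ (openGraph ω).Reachable x u :=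
        fun u => (KNSep.reachable_iff_cluster ω S' hxS' u).symm
      simp only [hGB, hr]
      by_cases h : ∃ u ∈ B, (openGraph ω).Reachable x u
      · rw [if_pos h, indicator_of_mem (show ω ∈ XBev from h)]; simp
      · rw [if_neg h, indicator_of_notMem (show ω ∉ XBev from h)]
    set NBT : Set (BondConfig V) := {ω : BondConfig V | ∀ t ∈ T, ∀ u ∈ B, ¬ (openGraph ω).Reachable t u} with hNBT
    have rHB : ∀ ω : BondConfig V, HB (⋃ t ∈ T, openEdgeCluster ω t) = NBT.indicator 1 ω := by
      intro ω
      have hr : ∀ t ∈ T, ∀ u, ((openGraph (⋃ t' ∈ T, openEdgeCluster ω t')).Reachable t u ↔ (openGraph ω).Reachable t u) :=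
        fun t ht u => (KNSep.reachable_iff_cluster ω T ht u).symm
      have hiff : (∀ t ∈ T, ∀ u ∈ B, ¬ (openGraph (⋃ t' ∈ T, openEdgeCluster ω t')).Reachable t u) ↔
          (∀ t ∈ T, ∀ u ∈ B, ¬ (openGraph ω).Reachable t u) := by
        constructor
        · intro h t ht u hu h'; exact h t ht u hu ((hr t ht u).2 h')
        · intro h t ht u hu h'; exact h t ht u hu ((hr t ht u).1 h')
      simp only [hHB]
      by_cases h : ∀ t ∈ T, ∀ u ∈ B, ¬ (openGraph ω).Reachable t u
      · rw [if_pos (hiff.2 h), indicator_of_mem (show ω ∈ NBT from h)]; simp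
      · rw [if_neg (fun h' => h (hiff.1 h')), indicator_of_notMem (show ω ∉ NBT from h)]
    -- (i) PA of `C_{S'}` given `S' ↮ T`
    have hi := BHK2006_setClusterConditionalPositiveAssociation (restrW S w) S' T FU GB hFU_mono hGB_mono
    simp_rw [rFU, rGB] at hi
    rw [setIntegral_indicator_one_eq μH Δ AU, setIntegral_indicator_one_eq μH Δ XBev,
      setIntegral_mul_indicator_one μH Δ XBev, setIntegral_indicator_one_eq μH (Δ ∩ XBev) AU] at hi
    -- hi : μH(Δ ∩ AU) * μH(Δ ∩ XBev) ≤ μH Δ * μH(Δ ∩ XBev ∩ AU)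
    -- (ii) two-set association given `{x} ↮ T` with the decreasing function `1{B ↮ T}` of `C_T`
    have hii := BHK2006_twoSetConditionalAssociation (restrW S w) ({x} : Set V) T (fun C _ => FU C) (fun _ D' => HB D')
      (fun _ => hFU_mono) (fun _ => antitone_const) (fun _ => monotone_const) (fun _ => hHB_anti)
    simp_rw [rFUx, rHB] at hii
    rw [setIntegral_indicator_one_eq μH Δx AU, setIntegral_indicator_one_eq μH Δx NBT,
      setIntegral_mul_indicator_one μH Δx NBT, setIntegral_indicator_one_eq μH (Δx ∩ NBT) AU] at hii
    -- hii : μH(Δx ∩ AU) * μH(Δx ∩ NBT) ≤ μH Δx * μH(Δx ∩ NBT ∩ AU)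
    -- identify the events
    have hTiff : ∀ (ω : BondConfig V) (s : V), (∀ t ∈ T, ¬ (openGraph ω).Reachable s t) ↔
        (¬ (openGraph ω).Reachable s y ∧ ¬ (openGraph ω).Reachable s z) := by
      intro ω s
      simp only [hT, mem_insert_iff, mem_singleton_iff, forall_eq_or_imp, forall_eq]
    have hyT : y ∈ T := by simp [hT]
    have hzT : z ∈ T := by simp [hT]
    have hTmem : ∀ t ∈ T, t = y ∨ t = z := by
      intro t ht; simpa [hT, mem_insert_iff, mem_singleton_iff] using ht
    have eΔx : Δx = E1 := by
      ext ω
      simp only [hΔx, hE1, mem_setOf_eq, mem_singleton_iff, forall_eq, mem_inter_iff, hTiff]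
    have eΔ : Δ = E1 ∩ NBT := by
      ext ω
      simp only [hΔ, hS', hE1, hNBT, mem_setOf_eq, mem_inter_iff, mem_insert_iff, Finset.mem_coe, forall_eq_or_imp, hTiff]
      constructor
      · rintro ⟨⟨hxy, hxz⟩, hB⟩
        refine ⟨⟨hxy, hxz⟩, fun t ht u hu htu => ?_⟩
        rcases hTmem t ht with rfl | rfl
        · exact (hB u hu).1 htu.symm
        · exact (hB u hu).2 htu.symm
      · rintro ⟨⟨hxy, hxz⟩, hB⟩
        refine ⟨⟨hxy, hxz⟩, fun u hu => ⟨fun h => hB y hyT u hu h.symm, fun h => hB z hzT u hu h.symm⟩⟩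
    have eXB : Δ ∩ XBev = XB B := by
      ext ω
      simp only [hΔ, hS', hXBev, hXB, mem_setOf_eq, mem_inter_iff, mem_insert_iff, Finset.mem_coe, forall_eq_or_imp, hTiff]
      constructor
      · rintro ⟨⟨-, hB⟩, hxB⟩
        exact ⟨hxB, fun u hu h => (hB u hu).1 h.symm, fun u hu h => (hB u hu).2 h.symm⟩
      · rintro ⟨⟨u, huB, hxu⟩, hyB, hzB⟩
        refine ⟨⟨⟨fun hxy => hyB u huB (hxy.symm.trans hxu), fun hxz => hzB u huB (hxz.symm.trans hxu)⟩,
          fun u' hu' => ⟨fun h => hyB u' hu' h.symm, fun h => hzB u' hu' h.symm⟩⟩, u, huB, hxu⟩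
    have hi' : μH.real (Δ ∩ AU) * μH.real (Δ ∩ XBev) ≤ μH.real Δ * μH.real (Δ ∩ XBev ∩ AU) := hi
    have hii' : μH.real (Δx ∩ AU) * μH.real (Δx ∩ NBT) ≤ μH.real Δx * μH.real (Δx ∩ NBT ∩ AU) := hii
    rw [eXB, eΔ] at hi'
    rw [eΔx] at hii'
    -- hi'  : μH(E1 ∩ NBT ∩ AU) * μH(XB B) ≤ μH(E1 ∩ NBT) * μH(XB B ∩ AU)
    -- hii' : μH(E1 ∩ AU) * μH(E1 ∩ NBT) ≤ μH(E1) * μH(E1 ∩ NBT ∩ AU)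
    have hsub : XB B ⊆ E1 ∩ NBT := by rw [← eXB, eΔ]; exact inter_subset_left
    by_cases h0 : μH.real (E1 ∩ NBT) = 0
    · have hX0 : μH.real (XB B) = 0 := le_antisymm (h0 ▸ measureReal_mono hsub) (hnH _)
      rw [hX0, zero_mul]
      exact mul_nonneg (hnH _) (hnH _)
    · have hpos : 0 < μH.real (E1 ∩ NBT) := lt_of_le_of_ne (hnH _) (Ne.symm h0)
      have ha := mul_le_mul_of_nonneg_left hii' (hnH (XB B))
      have hb := mul_le_mul_of_nonneg_left hi' (hnH E1)
      have h3 : μH.real (XB B) * μH.real (E1 ∩ AU) * μH.real (E1 ∩ NBT) ≤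
          μH.real E1 * μH.real (XB B ∩ AU) * μH.real (E1 ∩ NBT) := by nlinarith [ha, hb]
      exact le_of_mul_le_mul_right h3 hpos
  -- assemble
  have hsum : (∑ B ∈ A.powerset, μ.real (starEvent o ↑B) * μH.real (XB B)) * μH.real (E1 ∩ AU) ≤
      μH.real E1 * ∑ B ∈ A.powerset, μ.real (starEvent o ↑B) * μH.real (XB B ∩ AU) := by
    rw [Finset.sum_mul, Finset.mul_sum]
    refine Finset.sum_le_sum fun B hB => ?_
    have := mul_le_mul_of_nonneg_left (hstar B) (hn (starEvent o ↑B))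
    nlinarith [this]
  rw [← sa] at hsum
  rw [eE1, eE1U]
  have hs0 : 0 ≤ s0 := hn σ0
  have h2 : μ.real (openConn x o ∩ E1) * μH.real (E1 ∩ AU) ≤ μH.real E1 * μ.real (openConn x o ∩ E1 ∩ AU) :=
    hsum.trans (mul_le_mul_of_nonneg_left sU (hnH E1))
  nlinarith [mul_le_mul_of_nonneg_left h2 hs0]

end PocketCert

end

end Summit.CriticalPhenomena.PercolationContinuityZ3.Theorems
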